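import Literature.Geometry.Symplectic.EulerCharacteristicAddSignatureOfSymplecticFourOfHirzebruch
import Literature.Topology.FourManifolds.PontryaginNumberDisjointUnion
import Literature.Topology.FourManifolds.ComplexProjectiveSpaceCohomologyRing
import Literature.AlgebraicTopology.CharacteristicClasses.TautologicalGysin
import Literature.AlgebraicTopology.CharacteristicClasses.WhitneyLineCase
import Literature.AlgebraicTopology.CharacteristicClasses.TopologicalChernClassesProofs
import HarnessLib

/-!
# The signature theorem in dimension four, and `1 − b₁ + b⁺` even for symplectic `4`-manifolds, from Thom's `Ω₄ ≅ ℤ` alone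

F. Hirzebruch, *Topological Methods in Algebraic Geometry* (3rd ed. 1966), §8.2, **Thm. 8.2.2**
for `k = 1`: "`τ(M⁴) = L₁(p₁)[M⁴] = ⅓ p₁[M⁴]`".  Printed proof (Thm. 8.2.1–8.2.2 via Thm. 7.2.1 and
Thm. 7.2.3): the index `τ` and the Pontrjagin numbers are additive oriented-cobordism invariants, and
`Ω⁴ ⊗ ℚ` is generated by `P₂(ℂ)`, "for complex projective space `τ(P_{2k}(ℂ)) = 1`" (§8.2, p. 86)
while "the Pontrjagin class of the differentiable manifold `Pₙ(ℂ)` is `(1 + hₙ²)ⁿ⁺¹`" (**Thm. 4.10.2**,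
`hₙ ∈ H²(Pₙ(ℂ), ℤ)` "the generator defined in 4.2", i.e. `c(ηₙ) = 1 + hₙ` for the Hopf bundle,
Axiom IV), so `p₁[P₂(ℂ)] = 3`.

The tree already PROVES every step of this argument except Thom's theorem itself:

* Pontrjagin's theorem 7.2.1 (Pontryagin numbers are oriented-bordism invariants,
  `firstPontryaginNumber_eq_of_isOrientedBordant`, `PontryaginNumberBordismInvariance.lean`) and the
  assembly `kroneckerPairing_tangentPontryaginClass_eq_three_mul_signature_of_thom`
  (`PontryaginNumberDisjointUnion.lean`): **`⟨p₁(M), [M]_μ⟩ = 3 σ(M, μ)` for every closed smooth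
  `ℤ`-oriented `4`-manifold, from** (hT) Thom's `Ω₄ ≅ ℤ` in the form of the named fact
  `Literature.Topology.FourManifolds.isOrientedBordant_of_signature_eq` (Thom 1954, Thm. IV.13:
  equal signature ⇒ oriented bordant — NOT proved in the tree) and (h1) the seed "a `ℤ`-orientation
  `μ₁` of `ℂℙ²` with `σ = 1` and `⟨p₁, [ℂℙ²]_{μ₁}⟩ = 3`";
* `p₁(Tℂℙ²) = 3x²`, `x = c₁(γ¹)` (`tangentPontryaginClass_one_complexProjectiveSpace_two`,
  `ProjectiveSpaceEulerSequence.lean`, Milnor–Stasheff Example 15.6), whence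
  `⟨p₁, [ℂℙ²]_μ⟩ = 3 Q_μ(x, x)` (`pontryaginNumber_complexProjectivePlane`, `TopChernNumberFour.lean`).

This file PROVES the seed (h1) and assembles the consequences:

* `span_tautEuler_fin_three_eq_top`, `eL_tautLineBundle_two`, `span_xClassCP2_eq_top` — **`x = c₁(γ¹)`
  generates `H²(ℂℙ²; ℤ)`** (Milnor–Stasheff Thm. 14.4 / 14.10; Hirzebruch §4.2 Axiom IV "the generator
  `hₙ`"): by the Gysin surjectivity `⌣e(γ¹) : H⁰ ↠ H²` (`cup_tautEuler_surjective`,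
  `TautologicalGysin.lean`), `H⁰(ℂℙ²; ℤ) = ℤ · 1` (`ComplexProjectiveSpace.span_one_eq_top`), naturality of
  the Euler class under the identity bundle map `γ¹ → γ¹(ℂ³)` over the type synonym `ℂℙ² = ℙ(ℂ³)`
  (`eulerClass_bundleMap`) and `c₁(L) = -e(L)` for line bundles (`chernClassR_one_of_rank_one`);
* `cupPairing_xClassCP2_self_eq_one_or_eq_neg_one` — **`Q_μ(x, x) = ⟨x ⌣ x, [ℂℙ²]_μ⟩ = ±1`** for
  every `ℤ`-orientation `μ` (the cup form on the rank-one lattice `H²(ℂℙ²; ℤ)/T = ℤ x̄` is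
  unimodular by Poincaré duality, `isPerfPair_cupPairingModTorsion_holds`; Hatcher Cor. 3.39,
  Example 3.40);
* `signature_eq_one_of_cupPairing_xClassCP2_self_eq_one`,
  `pontryaginNumber_eq_three_mul_signature_complexProjectivePlane` — `σ(ℂℙ², μ) = Q_μ(x, x)` and
  **the signature theorem ON `ℂℙ²` unconditionally: `⟨p₁, [ℂℙ²]_μ⟩ = 3 σ(ℂℙ², μ)` for every `μ`**
  (Hirzebruch Thm. 4.10.2 with §8.2 p. 86 "`τ(P₂(ℂ)) = 1`");
* `exists_signature_eq_one_and_pontryaginNumber_eq_three_complexProjectivePlane` — **the seed (h1)**;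
* `signatureTheorem_four_of_thom` — **Thm. 8.2.2 (`k = 1`), `⟨p₁(M), [M]_μ⟩ = 3 σ(M, μ)` for every
  closed smooth `ℤ`-oriented `4`-manifold, from Thom's `Ω₄ ≅ ℤ` (hT) ALONE**;
* `hirzebruch_firstChernClass_sq_eq_almostComplex_four_of_thom` — the named fact
  `⟨c₁², [N]⟩ = 2χ + 3σ` for closed almost complex `4`-manifolds (McDuff–Salamon (4.1.7)) from (hT)
  alone (`⟨c₂, [N]⟩ = χ` and `p₁ = c₁² - 2c₂` being proved, `TopChernNumberFour.lean`);
* **`even_one_add_bOne_add_bPlus_of_symplectic_four_of_thom`** — the named fact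
  `even_one_add_bOne_add_bPlus_of_symplectic_four` (McDuff–Salamon 2017, §13.3 p. 527: `1 − b₁ + b⁺`
  is even for every closed symplectic `4`-manifold) from (hT) alone (Wu's formula `c₁ ≡ v₂ (mod 2)`
  being proved, `firstChernClass_modTwo_eq_wuClass_almostComplex_four_holds`).

Everything here is proved; no definitions, no named facts (D-0026).  After this file the ONLY
unproved input of `even_one_add_bOne_add_bPlus_of_symplectic_four` (and of
`hirzebruch_firstChernClass_sq_eq_almostComplex_four`) in the tree is Thom's theorem
`isOrientedBordant_of_signature_eq`.

## References

* [Hirzebruch1966] F. Hirzebruch, *Topological Methods in Algebraic Geometry*, 3rd ed., Grundlehren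
  131, Springer 1966, §4.2 Axiom IV, Thm. 4.10.2, §7.2 Thm. 7.2.1, §8.2 p. 86 and Thm. 8.2.2.
* [ThomCMH1954] R. Thom, *Quelques propriétés globales des variétés différentiables*, Comment. Math.
  Helv. 28 (1954) 17–86, Thm. IV.13 and Ch. IV §8 p. 81.
* [MilnorStasheff1974] J. Milnor, J. Stasheff, *Characteristic Classes*, Ann. of Math. Stud. 76,
  PUP 1974, Thm. 14.4, Thm. 14.10, Example 15.6, §19 (signature theorem).
* [McDuffSalamon2017] D. McDuff, D. Salamon, *Introduction to Symplectic Topology*, 3rd ed., OUP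
  2017, Rem. 4.1.10 (pp. 161–162, eq. (4.1.7)), §13.3 p. 527, Rem. 13.3.5.
* [HatcherAT2002] A. Hatcher, *Algebraic Topology*, CUP 2002, §3.3 Cor. 3.39, Example 3.40.
* [HusemollerFibreBundles1994] D. Husemoller, *Fibre Bundles*, 3rd ed., GTM 20, Springer 1994,
  Ch. 17 Prop. 3.3.
-/

noncomputable section

open scoped Manifold ContDiff Topology
open Set Function Module Bundle
open Literature.AlgebraicTopology.SingularHomology Literature.AlgebraicTopology.CharacteristicClasses
open Literature.Topology.FourManifolds Literature.Geometry.Kaehler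
open scoped LinearAlgebra.Projectivization

namespace Literature.Geometry.Symplectic

/-! ### `x = c₁(γ¹)` generates `H²(ℂℙ²; ℤ)` -/

section Generator

open ComplexVectorBundle

/-- **If `1` generates `H⁰(X; ℤ)` then every `y ⌣ x` with `y ∈ H⁰(X; ℤ)` is an integer multiple of
`x`** (span induction; the scalar case uses the `ℤ`-linearity of the tree's bilinear cup product in
its own module structure). [cite: HatcherAT2002, §3.2 p. 211 (1 ⌣ b = b)] -/
theorem cupProduct_mem_span_of_span_one_eq_top {X : Type} [TopologicalSpace X]
    (h1 : Submodule.span ℤ {singularCohomology.one ℤ X} = ⊤)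
    (y : singularCohomology ℤ ℤ X 0) (x : singularCohomology ℤ ℤ X 2) :
    cupProduct (show 0 + 2 = 0 + 2 from rfl) y x ∈ Submodule.span ℤ {(x : singularCohomology ℤ ℤ X (0 + 2))} := by
  have hy : y ∈ Submodule.span ℤ {singularCohomology.one ℤ X} := by
    rw [h1]
    exact Submodule.mem_top
  induction hy using Submodule.span_induction with
  | mem z hz =>
    rw [Set.mem_singleton_iff] at hz
    rw [hz, one_cupProduct]
    exact Submodule.mem_span_singleton_self _
  | zero =>
    rw [map_zero, LinearMap.zero_apply]
    exact Submodule.zero_mem _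
  | add z w _ _ hz hw =>
    rw [map_add, LinearMap.add_apply]
    exact Submodule.add_mem _ hz hw
  | smul r z _ hz =>
    -- `f (r • z) = r • f z` for the bilinear `f = cupProduct h`, its module instances supplied by unification
    have e := @LinearMap.map_smulₛₗ ℤ ℤ _ _ _ _ (_) (_) (_) (_) (RingHom.id ℤ)
      (cupProduct (R := ℤ) (X := X) (show 0 + 2 = 0 + 2 from rfl)) r z
    rw [RingHom.id_apply] at e
    rw [e]
    exact Submodule.smul_mem _ r hz

/-- **`e(γ¹)` generates `H²(ℙ(ℂ³); ℤ)`**: every class of `H²(ℙ(ℂ³); ℤ)` is `y ⌣ e(γ¹)` with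
`y ∈ H⁰(ℙ(ℂ³); ℤ) = ℤ · 1` (Gysin sequence of `γ¹`, Milnor–Stasheff Thm. 12.2 / proof of Thm. 14.4;
`H⁰ = ℤ · 1` transported from the tree's `ComplexProjectiveSpace.span_one_eq_top` along the identity
homeomorphism `ℙ(ℂ³) ≃ₜ ℂℙ²`). [cite: MilnorStasheff1974, §12 Thm. 12.2 and Thm. 14.4] -/
theorem span_tautEuler_fin_three_eq_top :
    Submodule.span ℤ {tautEuler (Fin 3 → ℂ) ℤ 1} = ⊤ := by
  -- `H⁰(ℙ(ℂ³); ℤ) = ℤ · 1`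
  set h := finProjectivizationHomeomorph 2 with hh
  have h1 : Submodule.span ℤ {singularCohomology.one ℤ (ℙ ℂ (Fin 3 → ℂ))} = ⊤ := by
    have := span_singleton_eq_top_of_equiv (singularCohomology.mapIso ℤ ℤ h 0).toLinearEquiv
      (ComplexProjectiveSpace.span_one_eq_top (n := 2))
    rwa [show (singularCohomology.mapIso ℤ ℤ h 0).toLinearEquiv (singularCohomology.one ℤ (ComplexProjectiveSpace 2)) =
        singularCohomology.map ℤ ℤ (h : C(ℙ ℂ (Fin 3 → ℂ), ComplexProjectiveSpace 2)) 0
          (singularCohomology.one ℤ (ComplexProjectiveSpace 2)) from rfl,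
      singularCohomology.map_one] at this
  -- Gysin: every degree-two class is `y ⌣ x` with `y ∈ H⁰ = ℤ · 1`
  refine Submodule.eq_top_iff'.2 fun c ↦ ?_
  have hV : finrank ℂ (Fin 3 → ℂ) = 3 := Module.finrank_fin_fun ℂ
  obtain ⟨y, hy⟩ := cup_tautEuler_surjective (Fin 3 → ℂ) ℤ hV (by norm_num) (k := 0) (by norm_num) c
  dsimp only at hy
  have := cupProduct_mem_span_of_span_one_eq_top h1 y (tautEuler (Fin 3 → ℂ) ℤ 1)
  rw [hy] at this
  exact this

/-- **`e(γ¹ → ℂℙ²)` is `e(γ¹(ℂ³))` read over the type synonym `ComplexProjectivePlane = ℙ(ℂ³)`**: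
naturality of the Euler class of line bundles (`eulerClass_bundleMap`, Husemoller (C₁)) under the
identity bundle map over the identity homeomorphism (the two bundles differ only in the bookkeeping of
the additive-group structure on the fibres). [cite: HusemollerFibreBundles1994, Ch. 17 Prop. 3.3] -/
theorem eL_tautLineBundle_two :
    (tautLineBundle 2).eL ℤ (rank_tautLineBundle 2) 1 =
      singularCohomology.map ℤ ℤ
        ((finProjectivizationHomeomorph 2).symm : C(ComplexProjectivePlane, ℙ ℂ (Fin 3 → ℂ))) 2
        (tautEuler (Fin 3 → ℂ) ℤ 1) := by
  set g : C(ComplexProjectivePlane, ℙ ℂ (Fin 3 → ℂ)) :=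
    ((finProjectivizationHomeomorph 2).symm : C(ComplexProjectivePlane, ℙ ℂ (Fin 3 → ℂ))) with hg
  let φ : ∀ b : ComplexProjectivePlane, (tautLineBundle 2).E b ≃L[ℂ] tautFiber ℂ (Fin 3 → ℂ) (g b) :=
    fun b ↦ ContinuousLinearEquiv.refl ℂ (tautFiber ℂ (Fin 3 → ℂ) b)
  have hΨ : Continuous fun q : TotalSpace (tautLineBundle 2).F (tautLineBundle 2).E ↦
      (⟨g q.proj, φ q.proj q.2⟩ : TotalSpace ℂ (tautFiber ℂ (Fin 3 → ℂ))) :=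
    continuous_id
  exact eulerClass_bundleMap (tautLineBundle 2).F ℂ (tautLineBundle 2).E (tautFiber ℂ (Fin 3 → ℂ))
    ((tautLineBundle 2).finrank_of_rank_one (rank_tautLineBundle 2)) (Module.finrank_self ℂ) ℤ φ hΨ 1

/-- `e(γ¹ → ℂℙ²)` generates `H²(ℂℙ²; ℤ)`. [cite: MilnorStasheff1974, Thm. 14.4] -/
theorem span_eL_tautLineBundle_two_eq_top :
    Submodule.span ℤ {(tautLineBundle 2).eL ℤ (rank_tautLineBundle 2) 1} = ⊤ := by
  rw [eL_tautLineBundle_two]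
  exact span_singleton_eq_top_of_equiv
    (singularCohomology.mapIso ℤ ℤ (finProjectivizationHomeomorph 2).symm 2).toLinearEquiv
    span_tautEuler_fin_three_eq_top

/-- **`c₁(γ¹) = -e(γ¹)` on `ℂℙ²`** (`c(L) = (1, -e(L), 0, …)` for a line bundle, Husemoller Ch. 17
Prop. 3.3, in the tree's sign convention). [cite: HusemollerFibreBundles1994, Ch. 17 Prop. 3.3] -/
theorem xClassCP2_eq_neg_eL : xClassCP2 = -(tautLineBundle 2).eL ℤ (rank_tautLineBundle 2) 1 := by
  change chernClassZ (tautLineBundle 2) 1 = _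
  rw [chernClassZ_eq, (tautLineBundle 2).chernClassR_one_of_rank_one ℤ (rank_tautLineBundle 2)]

/-- **`x = c₁(γ¹)` generates `H²(ℂℙ²; ℤ) ≅ ℤ`** (Milnor–Stasheff Thm. 14.4 / Thm. 14.10: `H*(ℂPⁿ; ℤ)`
is the truncated polynomial ring on `c₁(γ¹)`; Hirzebruch §4.2, Axiom IV: the generator `hₙ` with
`c(ηₙ) = 1 + hₙ`). [cite: MilnorStasheff1974, Thm. 14.4 and Thm. 14.10] [cite: Hirzebruch1966, §4.2 Axiom IV] -/
theorem span_xClassCP2_eq_top : Submodule.span ℤ {xClassCP2} = ⊤ := by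
  rw [xClassCP2_eq_neg_eL, span_singleton_neg_eq]
  exact span_eL_tautLineBundle_two_eq_top

/-- Its image generates the lattice `H²(ℂℙ²; ℤ)/T`. [folklore] -/
theorem span_mk_xClassCP2_eq_top :
    Submodule.span ℤ {(freeCohomology.mk xClassCP2 : freeCohomology ℤ ComplexProjectivePlane 2)} = ⊤ := by
  have h := congrArg (Submodule.map (freeCohomology.mk (R := ℤ) (X := ComplexProjectivePlane) (k := 2)))
    span_xClassCP2_eq_top
  rwa [Submodule.map_span, Set.image_singleton, Submodule.map_top,
    LinearMap.range_eq_top.2 freeCohomology.mk_surjective] at h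

end Generator

/-! ### `Q_μ(x, x) = ±1`, `σ(ℂℙ², μ) = Q_μ(x, x)` and `⟨p₁, [ℂℙ²]_μ⟩ = 3 σ(ℂℙ², μ)` -/

section ProjectivePlane

/-- **`⟨x ⌣ x, [ℂℙ²]_μ⟩ = ±1` for every `ℤ`-orientation `μ` of `ℂℙ²`**: the cup form on the
rank-one lattice `H²(ℂℙ²; ℤ)/T ≅ ℤ`, generated by `x̄`, is unimodular (Poincaré duality), so its
value on the generator is `±1` (Hatcher Cor. 3.39 and Example 3.40: "`α ⌣ α` generates `H⁴(ℂP²)`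
since the cup product pairing is nonsingular"). [cite: HatcherAT2002, §3.3 Cor. 3.39 and Example 3.40] -/
theorem cupPairing_xClassCP2_self_eq_one_or_eq_neg_one (μ : HomologicalOrientation ℤ ComplexProjectivePlane 4) :
    cupPairing μ two_add_two_eq_four xClassCP2 xClassCP2 = 1 ∨
      cupPairing μ two_add_two_eq_four xClassCP2 xClassCP2 = -1 := by
  set e := ComplexProjectivePlane.freeCohomologyTwoLinearEquivInt with he_def
  set b : Basis Unit ℤ (freeCohomology ℤ ComplexProjectivePlane 2) := (Basis.singleton Unit ℤ).map e.symm
    with hb_def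
  obtain ⟨g, hg⟩ := freeCohomology.mk_surjective (R := ℤ) (X := ComplexProjectivePlane) (b default)
  have hQ : (intersectionForm two_add_two_eq_four μ).IsPerfPair :=
    isPerfPair_intersectionForm _ μ isPerfPair_cupPairingModTorsion_holds
  -- the generator `g` of the lattice has `Q(g, g) = ±1`
  have hq : cupPairing μ two_add_two_eq_four g g = 1 ∨ cupPairing μ two_add_two_eq_four g g = -1 := by
    have h := apply_self_eq_one_or_eq_neg_one_of_isPerfPair (intersectionForm two_add_two_eq_four μ) hQ b
    rwa [← hg, intersectionForm_mk_mk] at h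
  -- `Q(x, x) = a² Q(g, g)` with `a = e x̄ = ±1`
  have hsq := apply_self_eq_sq_mul (intersectionForm two_add_two_eq_four μ) b (freeCohomology.mk xClassCP2)
  rw [intersectionForm_mk_mk, ← hg, intersectionForm_mk_mk] at hsq
  have hcoef : b.repr (freeCohomology.mk xClassCP2) default = e (freeCohomology.mk xClassCP2) := by
    rw [hb_def, Basis.map_repr, LinearEquiv.trans_apply, LinearEquiv.symm_symm, Basis.singleton_repr]
  have hgen : e (freeCohomology.mk xClassCP2) = 1 ∨ e (freeCohomology.mk xClassCP2) = -1 :=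
    (span_singleton_eq_top_iff_of_equiv e _).1 span_mk_xClassCP2_eq_top
  have h1 : (b.repr (freeCohomology.mk xClassCP2) default) ^ 2 = 1 := by
    rw [hcoef]
    rcases hgen with h | h <;> rw [h] <;> norm_num
  rw [h1, one_mul] at hsq
  rw [hsq]
  exact hq

/-- Reversing the orientation negates the cup pairing: `Q_{-μ}(a, b) = -Q_μ(a, b)`
(`[X]_{-μ} = -[X]_μ`, Hatcher Lemma 3.27(a)). [cite: HatcherAT2002, §3.3 Lemma 3.27(a)] -/
theorem cupPairing_neg_orientation {X : Type} [TopologicalSpace X] [T2Space X] [CompactSpace X]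
    [ChartedSpace (EuclideanSpace ℝ (Fin 4)) X] (μ : HomologicalOrientation ℤ X 4)
    (a b : singularCohomology ℤ ℤ X 2) :
    cupPairing (-μ) two_add_two_eq_four a b = -cupPairing μ two_add_two_eq_four a b := by
  rw [cupPairing_apply, cupPairing_apply, HomologicalOrientation.fundamentalClass_neg_holds ℤ X 4 μ,
    map_neg]

/-- **`Q_μ(x, x) = 1 ⇒ σ(ℂℙ², μ) = 1`**: a class of positive square gives `b⁺ ≥ 1`
(`one_le_sigPos_intersectionForm_of_sq_pos`), and `b⁺ + b⁻ = b₂(ℂℙ²) = 1`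
(`finrank_eq_sigPos_add_sigNeg_intersectionForm_holds`, `ComplexProjectivePlane.finrank_freeCohomology_two`).
[cite: Hirzebruch1966, §8.2 p. 86 ("τ(P₂(ℂ)) = 1")] [cite: HatcherAT2002, §3.3 Example 3.40] -/
theorem signature_eq_one_of_cupPairing_xClassCP2_self_eq_one (μ : HomologicalOrientation ℤ ComplexProjectivePlane 4)
    (h : cupPairing μ two_add_two_eq_four xClassCP2 xClassCP2 = 1) : μ.signature = 1 := by
  have h1 : 1 ≤ sigPos (intersectionForm two_add_two_eq_four μ).toQuadraticMap :=
    one_le_sigPos_intersectionForm_of_sq_pos two_add_two_eq_four μ (freeCohomology.mk xClassCP2)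
      (by rw [intersectionForm_mk_mk, h]; exact one_pos)
  have h2 := finrank_eq_sigPos_add_sigNeg_intersectionForm_holds (X := ComplexProjectivePlane) even_two
    two_add_two_eq_four μ
  rw [ComplexProjectivePlane.finrank_freeCohomology_two] at h2
  change (sigPos (intersectionForm two_add_two_eq_four μ).toQuadraticMap : ℤ) -
      sigNeg (intersectionForm two_add_two_eq_four μ).toQuadraticMap = 1
  omega

/-- **`σ(ℂℙ², μ) = Q_μ(x, x)` (`= ±1`)** for every `ℤ`-orientation `μ`. [cite: Hirzebruch1966, §8.2 p. 86] -/
theorem signature_complexProjectivePlane_eq_cupPairing (μ : HomologicalOrientation ℤ ComplexProjectivePlane 4) :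
    μ.signature = cupPairing μ two_add_two_eq_four xClassCP2 xClassCP2 := by
  rcases cupPairing_xClassCP2_self_eq_one_or_eq_neg_one μ with h | h
  · rw [h, signature_eq_one_of_cupPairing_xClassCP2_self_eq_one μ h]
  · have hneg : cupPairing (-μ) two_add_two_eq_four xClassCP2 xClassCP2 = 1 := by
      rw [cupPairing_neg_orientation, h, neg_neg]
    have hs := signature_eq_one_of_cupPairing_xClassCP2_self_eq_one (-μ) hneg
    rw [HomologicalOrientation.signature_neg_holds μ] at hs
    rw [h]
    omega

/-- **The signature theorem on `ℂℙ²`, unconditionally: `⟨p₁(Tℂℙ²), [ℂℙ²]_μ⟩ = 3 σ(ℂℙ², μ)` for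
every `ℤ`-orientation `μ`** (`p₁ = 3x²`, Hirzebruch Thm. 4.10.2 / Milnor–Stasheff Example 15.6,
and `σ = Q(x, x)`). [cite: Hirzebruch1966, Thm. 4.10.2 and §8.2 p. 86] [cite: MilnorStasheff1974, Example 15.6] -/
theorem pontryaginNumber_eq_three_mul_signature_complexProjectivePlane
    (μ : HomologicalOrientation ℤ ComplexProjectivePlane 4) :
    kroneckerPairing ℤ ℤ ComplexProjectivePlane 4
        (degCast ℤ (by norm_num : 4 * 1 = 4) (tangentPontryaginClass (𝓡 4) ComplexProjectivePlane 1))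
        μ.fundamentalClass = 3 * μ.signature := by
  rw [pontryaginNumber_complexProjectivePlane, signature_complexProjectivePlane_eq_cupPairing]

/-- **The seed of Hirzebruch's comparison: a `ℤ`-orientation `μ₁` of `ℂℙ²` with `σ = 1` and
`⟨p₁, [ℂℙ²]_{μ₁}⟩ = 3`** (hypothesis `h1` of
`kroneckerPairing_tangentPontryaginClass_eq_three_mul_signature_of_thom`; Hirzebruch Thm. 4.10.2 with
§8.2 p. 86, Thom p. 81 "pour `PC(2)`, `τ = 1`"). [cite: Hirzebruch1966, Thm. 4.10.2 and §8.2 p. 86] [cite: ThomCMH1954, Ch. IV §8 p. 81] -/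
theorem exists_signature_eq_one_and_pontryaginNumber_eq_three_complexProjectivePlane :
    ∃ μ₁ : HomologicalOrientation ℤ ComplexProjectivePlane 4, μ₁.signature = 1 ∧
      kroneckerPairing ℤ ℤ ComplexProjectivePlane 4
        (degCast ℤ (by norm_num : 4 * 1 = 4) (tangentPontryaginClass (𝓡 4) ComplexProjectivePlane 1))
        μ₁.fundamentalClass = 3 := by
  obtain ⟨μ₀, -⟩ := exists_signature_complexProjectivePlane_eq_one_holds
  -- an orientation with `Q(x, x) = +1`
  obtain ⟨μ, hμ⟩ : ∃ μ : HomologicalOrientation ℤ ComplexProjectivePlane 4,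
      cupPairing μ two_add_two_eq_four xClassCP2 xClassCP2 = 1 := by
    rcases cupPairing_xClassCP2_self_eq_one_or_eq_neg_one μ₀ with h | h
    · exact ⟨μ₀, h⟩
    · exact ⟨-μ₀, by rw [cupPairing_neg_orientation, h, neg_neg]⟩
  exact ⟨μ, signature_eq_one_of_cupPairing_xClassCP2_self_eq_one μ hμ,
    by rw [pontryaginNumber_complexProjectivePlane, hμ, mul_one]⟩

end ProjectivePlane

/-! ### The signature theorem in dimension four and the two named facts, from Thom's `Ω₄ ≅ ℤ` -/

section Thom

/-- **Hirzebruch's signature theorem in dimension four from Thom's `Ω₄ ≅ ℤ` alone**: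
granted `isOrientedBordant_of_signature_eq` (Thom 1954, Thm. IV.13: closed smooth `ℤ`-oriented
`4`-manifolds of equal signature are oriented bordant), `⟨p₁(M), [M]_μ⟩ = 3 σ(M, μ)` for every closed
smooth `ℤ`-oriented `4`-manifold (Thm. 8.2.2, `k = 1`).  The comparison seed on `ℂℙ²` is now proved
(`exists_signature_eq_one_and_pontryaginNumber_eq_three_complexProjectivePlane`); Pontrjagin's
bordism invariance (Thm. 7.2.1) and the assembly are the tree's
`kroneckerPairing_tangentPontryaginClass_eq_three_mul_signature_of_thom`.
[cite: Hirzebruch1966, Thm. 8.2.2 (k = 1)] [cite: ThomCMH1954, Thm IV.13] -/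
theorem signatureTheorem_four_of_thom (hT : isOrientedBordant_of_signature_eq.{0})
    (M : Type) [TopologicalSpace M] [T2Space M] [SecondCountableTopology M]
    [ChartedSpace (EuclideanSpace ℝ (Fin 4)) M] [CompactSpace M] [IsManifold (𝓡 4) ∞ M]
    (μ : HomologicalOrientation ℤ M 4) :
    kroneckerPairing ℤ ℤ M 4 (degCast ℤ (by norm_num : 4 * 1 = 4) (tangentPontryaginClass (𝓡 4) M 1)) μ.fundamentalClass =
      3 * μ.signature :=
  kroneckerPairing_tangentPontryaginClass_eq_three_mul_signature_of_thom hT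
    exists_signature_eq_one_and_pontryaginNumber_eq_three_complexProjectivePlane M μ

/-- **(H) `⟨c₁², [N]⟩ = 2χ + 3σ` for closed almost complex `4`-manifolds (McDuff–Salamon (4.1.7);
the named fact `hirzebruch_firstChernClass_sq_eq_almostComplex_four`) from Thom's `Ω₄ ≅ ℤ` alone**
(`⟨c₂, [N]⟩ = χ`, `p₁ = c₁² - 2c₂` and now the signature theorem modulo Thom are proved).
[cite: McDuffSalamon2017, Rem. 4.1.10 eq. (4.1.7) (pp. 161–162)] [cite: Hirzebruch1966, Thm. 4.5.1, Thm. 4.10.1, Thm. 8.2.2] [cite: ThomCMH1954, Thm IV.13] -/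
theorem hirzebruch_firstChernClass_sq_eq_almostComplex_four_of_thom (hT : isOrientedBordant_of_signature_eq.{0}) :
    hirzebruch_firstChernClass_sq_eq_almostComplex_four :=
  hirzebruch_firstChernClass_sq_eq_almostComplex_four_of_signatureTheorem
    fun N _ _ _ _ _ _ _ μ ↦ signatureTheorem_four_of_thom hT N μ

/-- **`even_one_add_bOne_add_bPlus_of_symplectic_four` from Thom's `Ω₄ ≅ ℤ` alone**: for every
closed symplectic `4`-manifold `1 − b₁ + b⁺` (equivalently `1 + b₁ + b⁺`) is even (McDuff–Salamon
2017, §13.3 p. 527, via Rem. 4.1.10: `c₁² = 2χ + 3σ` and `c₁` an integral lift of `w₂`).  Every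
other input of the printed argument — Wu's formula `c₁ ≡ v₂ (mod 2)`, van der Blij's lemma, the top
Chern number `⟨c₂, [N]⟩ = χ`, `p₁ = c₁² - 2c₂`, Pontrjagin's bordism invariance and the `ℂℙ²` seed —
is a theorem of the tree; the one remaining hypothesis is Thom's `isOrientedBordant_of_signature_eq`.
[cite: McDuffSalamon2017, §13.3 p. 527, Rem. 13.3.5 and Rem. 4.1.10] [cite: Hirzebruch1966, Thm. 8.2.2] [cite: ThomCMH1954, Thm IV.13] -/
theorem even_one_add_bOne_add_bPlus_of_symplectic_four_of_thom (hT : isOrientedBordant_of_signature_eq.{0}) :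
    even_one_add_bOne_add_bPlus_of_symplectic_four :=
  even_one_add_bOne_add_bPlus_of_symplectic_four_of_signatureTheorem
    fun N _ _ _ _ _ _ _ μ ↦ signatureTheorem_four_of_thom hT N μ

/-- The almost complex form: from Thom's `Ω₄ ≅ ℤ` alone, `1 + b₁ + b⁺` is even for every closed
connected almost complex `4`-manifold with its complex orientation. [cite: McDuffSalamon2017, Rem. 4.1.10 and §13.3 p. 527] -/
theorem even_one_add_bOne_add_bPlus_almostComplex_four_of_thom (hT : isOrientedBordant_of_signature_eq.{0})
    {N : Type} [TopologicalSpace N] [T2Space N] [SecondCountableTopology N] [CompactSpace N]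
    [ConnectedSpace N] [ChartedSpace (EuclideanSpace ℝ (Fin 4)) N] [IsManifold (𝓡 4) ∞ N]
    (J : AlmostComplexStructure (𝓡 4) ∞ N) (μ : HomologicalOrientation ℤ N 4)
    (hμ : μ.IsComplexOrientationOf J) :
    Even (1 + Module.finrank ℤ (singularHomology ℤ ℤ N 1) +
      sigPos (intersectionForm two_add_two_eq_four μ).toQuadraticMap) :=
  even_one_add_bOne_add_bPlus_almostComplex_four_of_hirzebruch
    (hirzebruch_firstChernClass_sq_eq_almostComplex_four_of_thom hT) J μ hμ

end Thom

end Literature.Geometry.Symplectic
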